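import Summits.ResolutionOfSingularities.ResolutionOfSingularities.Theorems.ValuativeLuAlphaPTorsorSequenceModel
import Summits.ResolutionOfSingularities.ResolutionOfSingularities.Theorems.ValuativeLuAlphaPTorsorRingEquivTransport

/-!
# The schema hypotheses along the pulled-back quadratic sequence (stub W-a)

Helper file for the stub `sequence_schema` (W-a) of the line `pfaff-line-log-final-forms`
(crux `Valuative.LuAlphaPTorsor`, item `stmt-ResolutionOfSingularities-0641`).

Setting: `K/k` fields with `char k = p`, `O` a valuation ring of `K`, `A₀ ⊆ O` a finitely
generated `k`-subalgebra of `K`, regular at the centre `𝔪_O ∩ A₀`. The Giraud induction of the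
line runs along a sequence `R : ℕ → Subring K'` of quadratic transforms along the pulled-back
valuation ring `O.comap ι` inside the subfield `K' = Frac A₀ = Subfield.closure A₀` (embedded by
`ι`), starting at the local ring of the pulled-back base at the centre. This file checks, for
every member `R n`, the four hypotheses the induction consumes ("the schema"):

* `R n` is a regular local ring (`isRegularLocalRing_sequence`, from the regularity of the base
  transported along `exists_ringEquiv_atPrime`);
* richness of `Der_ℤ(R n)` — every `ψ`-derivation is, on a finite set, a finite combination of
  `ℤ`-derivations (`rich_localization_centre` on a finitely generated model of `R n`,
  `exists_model_of_sequence_member`, transported by `rich_of_ringEquiv`);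
* dual derivations of every pair generating the non-units, at the two-dimensional stages
  (`exists_dual_derivations_centre`, transported by `duals_of_ringEquiv`);
* `R n` is a quotient of a localized polynomial ring `k[X]_𝔮` (`exists_presentation`,
  `exists_surjective_lift`).

All [folklore]; the work is the model bookkeeping of `…SequenceModel.lean`.
-/

set_option linter.dupNamespace false

namespace Summit.ResolutionOfSingularities.ResolutionOfSingularities.Theorems.PfaffLine

open IsLocalRing Literature.AlgebraicGeometry.Resolution

/-! ## The schema on the local ring of a finitely generated model, and its transport -/

/-- **Presentations transport along ring isomorphisms.** If `R'` is a local ring isomorphic to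
the local ring `A_𝔭` of a finitely generated model `A ⊆ O` at the centre `𝔭 = 𝔪_O ∩ A`, then
`R'` is a quotient of a localized polynomial ring: `Φq : k[X_1, …, X_m]_𝔮 ↠ R'` for some prime
`𝔮` (compose the presentation of `exists_presentation` with `e⁻¹` and lift it with
`exists_surjective_lift`). [folklore] -/
theorem exists_presentation_of_ringEquiv {k K : Type} [Field k] [Field K] [Algebra k K]
    (O : ValuationSubring K) (A : Subalgebra k K) (h : A.toSubring ≤ O.toSubring) (hfg : A.FG)
    {R' : Type} [CommRing R'] [IsLocalRing R']
    (e : R' ≃+* Localization.AtPrime (Ideal.comap (Subring.inclusion h) (maximalIdeal O))) :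
    ∃ (m : ℕ) (𝔮 : Ideal (MvPolynomial (Fin m) k)) (_ : 𝔮.IsPrime)
      (Φq : Localization.AtPrime 𝔮 →+* R'), Function.Surjective Φq := by
  obtain ⟨n, Φ, hΦ⟩ := exists_presentation O A h hfg
  -- the composite presentation `k[X] → A_𝔭 ≃ R'`
  let Φ' : MvPolynomial (Fin n) k →+* R' := e.symm.toRingHom.comp Φ
  have hΦ' : ∀ r, ∃ F G, IsUnit (Φ' G) ∧ r * Φ' G = Φ' F := fun r => by
    obtain ⟨F, G, hG, hr⟩ := hΦ (e r)
    refine ⟨F, G, hG.map e.symm.toRingHom, ?_⟩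
    show r * e.symm (Φ G) = e.symm (Φ F)
    rw [← hr, map_mul, e.symm_apply_apply]
  obtain ⟨Φq, hsurj, -⟩ := exists_surjective_lift Φ' hΦ'
  exact ⟨n, Ideal.comap Φ' (maximalIdeal _), inferInstance, Φq, hsurj⟩

/-- **Dual derivations on the two-dimensional local ring of a finitely generated model at the
centre.** For `A ⊆ O` finitely generated with `A_𝔭` regular of dimension two at the centre, every
pair `v₀, v₁` generating exactly the ideal of non-units of `A_𝔭` (i.e. `(v₀, v₁) = 𝔪`) admits
dual `ℤ`-derivations `D_l (v_j) = δ_lj` (`exists_dual_derivations_centre` with `d = 2`).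
[folklore] -/
theorem duals_localization_centre (p : ℕ) [Fact p.Prime] {k K : Type} [Field k] [CharP k p]
    [Field K] [Algebra k K] (O : ValuationSubring K) (A : Subalgebra k K)
    (h : A.toSubring ≤ O.toSubring) (hfg : A.FG)
    (hreg : IsRegularLocalRing
      (Localization.AtPrime (Ideal.comap (Subring.inclusion h) (maximalIdeal O))))
    (hdim : ringKrullDim
      (Localization.AtPrime (Ideal.comap (Subring.inclusion h) (maximalIdeal O))) = 2)
    (v : Fin 2 → Localization.AtPrime (Ideal.comap (Subring.inclusion h) (maximalIdeal O)))
    (hv : ∀ z, z ∈ Ideal.span (Set.range v) ↔ ¬ IsUnit z) :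
    ∃ D : Fin 2 → Derivation ℤ
      (Localization.AtPrime (Ideal.comap (Subring.inclusion h) (maximalIdeal O)))
      (Localization.AtPrime (Ideal.comap (Subring.inclusion h) (maximalIdeal O))),
      ∀ l j, D l (v j) = if l = j then 1 else 0 := by
  -- the pair generates the maximal ideal
  have hspan : Ideal.span (Set.range v) =
      maximalIdeal (Localization.AtPrime (Ideal.comap (Subring.inclusion h) (maximalIdeal O))) := by
    ext z
    rw [hv z, mem_maximalIdeal, mem_nonunits_iff]
  have hdim' : ringKrullDim
      (Localization.AtPrime (Ideal.comap (Subring.inclusion h) (maximalIdeal O))) =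
        ((2 : ℕ) : WithBot ℕ∞) := by
    rw [hdim]; rfl
  exact exists_dual_derivations_centre p k K O A h hfg hreg v hspan hdim'

/-! ## The schema along the pulled-back quadratic sequence -/

/-- **The schema along the pulled-back quadratic sequence, for a general field embedding.** For
`A₀ ⊆ O` finitely generated, regular at the centre, inside the range of `ι : K' →+* K`, and a
sequence `R` of quadratic transforms along `O.comap ι` starting at the local ring of
`A₀.comap ι` at the centre: every `R n` is regular (`isRegularLocalRing_sequence`), rich in
`ℤ`-derivations, has dual derivations at the two-dimensional stages, and is a quotient of a
localized polynomial ring — the last three transported along the isomorphism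
`R n ≃ (A₁)_{𝔪_O ∩ A₁}` with a finitely generated model `A₁` of `exists_model_of_sequence_member`.
[folklore] -/
theorem sequence_schema_of_ringHom (p : ℕ) [Fact p.Prime] {k K K' : Type} [Field k] [CharP k p]
    [Field K] [Algebra k K] [Field K'] (ι : K' →+* K) (O : ValuationSubring K)
    (A₀ : Subalgebra k K) (h₀ : A₀.toSubring ≤ O.toSubring) (hfg : A₀.FG)
    (hreg : IsRegularLocalRing
      (Localization.AtPrime (Ideal.comap (Subring.inclusion h₀) (maximalIdeal O))))
    (hA₀ : A₀.toSubring ≤ ι.range) {R : ℕ → Subring K'}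
    (hR0 : R 0 = locAtCentre (A₀.toSubring.comap ι) (O.comap ι))
    (hstep : ∀ i, IsQuadraticTransformAlong (O.comap ι) (R i) (R (i + 1))) (n : ℕ) :
    IsRegularLocalRing (R n) ∧
    (∀ (N : Type) [CommRing N] (ψ : R n →+* N) (δ₀ : R n →+ N),
      (∀ a b, δ₀ (a * b) = ψ a * δ₀ b + ψ b * δ₀ a) → ∀ Y : Finset (R n),
        ∃ (m : ℕ) (Δ : Fin m → Derivation ℤ (R n) (R n)) (nn : Fin m → N),
          ∀ y ∈ Y, δ₀ y = Finset.univ.sum fun j => ψ (Δ j y) * nn j) ∧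
    (∀ (v : Fin 2 → R n), ringKrullDim (R n) = 2 →
      (∀ z : R n, z ∈ Ideal.span (Set.range v) ↔ ¬ IsUnit z) →
        ∃ D : Fin 2 → Derivation ℤ (R n) (R n), ∀ l j, D l (v j) = if l = j then 1 else 0) ∧
    (∃ (m : ℕ) (𝔮 : Ideal (MvPolynomial (Fin m) k)) (_ : 𝔮.IsPrime)
      (Φq : Localization.AtPrime 𝔮 →+* R n), Function.Surjective Φq) := by
  -- (1) regularity of `R 0`, transported from the base, then along the sequence
  have hR0' : (locAtCentre A₀.toSubring O).comap ι = R 0 :=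
    (comap_locAtCentre ι O hA₀).trans hR0.symm
  obtain ⟨e₀, -⟩ := exists_ringEquiv_atPrime ι O A₀.toSubring h₀ hA₀ hR0'
  have hreg0 : IsRegularLocalRing (R 0) := by
    haveI := hreg
    exact IsRegularLocalRing.of_ringEquiv e₀.symm
  have hregn : IsRegularLocalRing (R n) := isRegularLocalRing_sequence hreg0 hstep n
  -- (2) a finitely generated model `A₁` of `R n`, `R n ≃ (A₁)_{𝔪_O ∩ A₁}`
  obtain ⟨A₁, h₁, -, hfg₁, -, -, e, -⟩ :=
    exists_model_of_sequence_member k K K' ι O A₀ h₀ hfg hA₀ R hR0 hstep n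
  haveI := hregn
  have hregL : IsRegularLocalRing
      (Localization.AtPrime (Ideal.comap (Subring.inclusion h₁) (maximalIdeal O))) :=
    IsRegularLocalRing.of_ringEquiv e
  -- (3) richness, (5) presentation: transported from the model
  refine ⟨hregn, rich_of_ringEquiv e (rich_localization_centre p k K O A₁ h₁ hfg₁ hregL),
    fun v hdim hv => ?_, exists_presentation_of_ringEquiv O A₁ h₁ hfg₁ e⟩
  -- (4) dual derivations at a two-dimensional stage
  have hdimL : ringKrullDim
      (Localization.AtPrime (Ideal.comap (Subring.inclusion h₁) (maximalIdeal O))) = 2 := by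
    rw [← ringKrullDim_eq_of_ringEquiv e]; exact hdim
  exact duals_of_ringEquiv e
    (fun v' hv' => duals_localization_centre p O A₁ h₁ hfg₁ hregL hdimL v' hv') v hv

/-- **W-a, the schema along the pulled-back quadratic sequence.** For `A₀ ⊆ O` a finitely
generated `k`-subalgebra of `K` (`char k = p`), regular of dimension two at the centre of the
valuation ring `O`, and a sequence `R` of quadratic transforms along the pull-back of `O` to
`K' = Subfield.closure A₀` starting at the local ring of the pulled-back base at the centre:
every member `R n` is a regular local ring, is rich in `ℤ`-derivations (every `ψ`-derivation is,
on a finite set, a finite combination of `ℤ`-derivations), admits dual derivations of every pair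
generating the non-units whenever `dim (R n) = 2`, and is a quotient of a localized polynomial
ring `k[X_1, …, X_m]_𝔮`. Instance of `sequence_schema_of_ringHom` for the embedding of the
subfield `Subfield.closure A₀ ⊇ A₀`. [folklore] -/
theorem sequence_schema : ∀ (p : ℕ) [Fact p.Prime] (k K : Type) [Field k] [CharP k p] [Field K] [Algebra k K] (O : ValuationSubring K) (A₀ : Subalgebra k K) (h₀ : A₀.toSubring ≤ O.toSubring), A₀.FG → IsRegularLocalRing (Localization.AtPrime (Ideal.comap (Subring.inclusion h₀) (IsLocalRing.maximalIdeal O))) → ringKrullDim (Localization.AtPrime (Ideal.comap (Subring.inclusion h₀) (IsLocalRing.maximalIdeal O))) = 2 → ∀ (R : ℕ → Subring (Subfield.closure (A₀ : Set K))), R 0 = Literature.AlgebraicGeometry.Resolution.locAtCentre (A₀.toSubring.comap (Subfield.closure (A₀ : Set K)).subtype) (O.comap (Subfield.closure (A₀ : Set K)).subtype) → (∀ i, Literature.AlgebraicGeometry.Resolution.IsQuadraticTransformAlong (O.comap (Subfield.closure (A₀ : Set K)).subtype) (R i) (R (i + 1))) → ∀ (n : ℕ), IsRegularLocalRing (R n)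 ∧ (∀ (N : Type) [CommRing N] (ψ : R n →+* N) (δ₀ : R n →+ N), (∀ a b, δ₀ (a * b) = ψ a * δ₀ b + ψ b * δ₀ a) → ∀ Y : Finset (R n), ∃ (m : ℕ) (Δ : Fin m → Derivation ℤ (R n) (R n)) (nn : Fin m → N), ∀ y ∈ Y, δ₀ y = Finset.univ.sum fun j => ψ (Δ j y) * nn j) ∧ (∀ (v : Fin 2 → R n), ringKrullDim (R n) = 2 → (∀ z : R n, z ∈ Ideal.span (Set.range v) ↔ ¬ IsUnit z) → ∃ D : Fin 2 → Derivation ℤ (R n) (R n), ∀ l j, D l (v j) = if l = j then 1 else 0) ∧ (∃ (m : ℕ) (𝔮 : Ideal (MvPolynomial (Fin m) k)) (_ : 𝔮.IsPrime) (Φq : Localization.AtPrime 𝔮 →+* R n), Function.Surjective Φq) := by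
  intro p _ k K _ _ _ _ O A₀ h₀ hfg hreg _ R hR0 hstep n
  -- `A₀` lies in the range of the embedding of `Subfield.closure A₀`
  have hA₀ : A₀.toSubring ≤ (Subfield.closure (A₀ : Set K)).subtype.range := fun x hx =>
    ⟨⟨x, Subfield.subset_closure hx⟩, rfl⟩
  exact sequence_schema_of_ringHom p (Subfield.closure (A₀ : Set K)).subtype O A₀ h₀ hfg hreg hA₀
    hR0 hstep n

end Summit.ResolutionOfSingularities.ResolutionOfSingularities.Theorems.PfaffLine
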